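import Literature.Combinatorics.LorentzianPolynomials.HodgeRiemann
import HarnessLib

/-!
# Identifying variables preserves Lorentzian polynomials: `f(v_{φ(1)}, …, v_{φ(n)}) ∈ L^d_m` for `f ∈ L^d_n` and
# ANY map `φ : [n] → [m]` (Brändén–Huh 2020, Thm. 2.10 (III) "the diagonalization `f(w_1, …, w_{n-1}, w_{n-1})` is
# in `L^d_{n-1}`", general form)

Layer `Literature/Combinatorics/LorentzianPolynomials`, namespace `Literature.Combinatorics.LorentzianPolynomials`;
lane `lit-hodgefound` (Track 2 foundations library), seat p16, generation 28 (row g28-#5). Theorems only (no definition,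
no named fact; net debt 0), for the tree's Definition-2.6 `lorentzian`.

## Source (verbatim) — [BrandenHuh2019] P. Brändén, J. Huh, *Lorentzian polynomials*, Ann. of Math. 192 (2020),
## arXiv:1902.03719 (held `paper:arxiv-1902.03719`), §2.2

**Theorem 2.10.** "If `f(w) ∈ L^d_n`, then `f(Av) ∈ L^d_m` for any `n × m` matrix `A` with nonnegative entries." Proof:
"Note that Theorem 2.10 follows from its three special cases: (I) the elementary splitting […], (II) the dilation […],
(III) the diagonalization `f(w_1, …, w_{n-2}, w_{n-1}, w_{n-1})` is in `L^d_{n-1}` […] an elementary aggregation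
preserves M-convexity, and hence `f(w_1, …, w_{n-1}, w_{n-1} + w_n) ∈ M^d_n`. Therefore, Proposition 2.7 implies that
`lim_{k→∞} (1 + w_{n-1}∂_n/k)^k f = f(w_1, …, w_{n-1}, w_{n-1} + w_n) ∈ L^d_n`. By the second statement, we may
substitute `w_n` in the displayed equation by zero." Corollary 2.11: "If `f ∈ L^d_n`, then `Σ a_i ∂_i f ∈ L^{d-1}_n`".

## What is proved, and how (Cor. 2.11 in place of Brändén–Huh's limit argument)

For `φ : σ → τ` arbitrary, `rename φ f = f(X_i ↦ v_{φ(i)})` is the polynomial obtained by identifying all variables in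
each fibre of `φ` (and renaming); a diagonalization is `φ` with one two-element fibre, the tree's
`rename_mem_lorentzian` (`Substitution.lean`, injective `φ`) the case of one-element fibres.
* §1 the chain rule **`pderiv_rename`**: `∂_k (f ∘ φ^*) = (D_{𝟙_{φ⁻¹(k)}} f) ∘ φ^*`, i.e.
  `pderiv k (rename φ f) = rename φ (dirDeriv (𝟙_{φ = k}) f)` (a nonnegative directional derivative), and its iterate
  `exists_iterPderiv_rename_eq` (`∂^α (rename φ f) = rename φ g` with `g ∈ L²` obtained from `f` by `|α|` such
  derivatives — Cor. 2.11, `dirDeriv_mem_lorentzian`);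
* §2 coefficients and support: `coeff_rename_eq_sum` (`coeff_γ (rename φ f) = Σ_{φ_* α = γ} coeff_α f`), nonnegativity,
  `support_rename_eq_image` (`supp (rename φ f) = φ_* (supp f)` — no cancellation), M-convex by AGGREGATION
  (`IsMConvex.image_mapDomain_of_any`, g28-#2);
* §3 the Hessian of `rename φ q`, `q` quadratic, is the pull-back of that of `q` along `v ↦ v ∘ φ`
  (`toBilin'_hessian_rename`), so its positive index does not exceed that of `q` (Serre; `sigPos_le_sigPos_of_comp`);
* §4 **`rename_mem_lorentzian_of_any`**: `f ∈ lorentzian σ d ⟹ rename φ f ∈ lorentzian τ d` for every `φ : σ → τ`.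
-/

noncomputable section

open MvPolynomial Finsupp Finset Matrix
open Literature.LinearAlgebra.QuadraticForm

namespace Literature.Combinatorics.LorentzianPolynomials

variable {σ τ : Type*} [Fintype σ] [Fintype τ]

/-! ## §1 The chain rule for `rename φ` and nonnegative directional derivatives -/

section ChainRule

omit [Fintype τ] in
/-- `D_a` is additive in the polynomial. [cite: BrandenHuh2019, §2.2 Cor. 2.11] -/
theorem dirDeriv_add_right (a : σ → ℝ) (f g : MvPolynomial σ ℝ) : dirDeriv a (f + g) = dirDeriv a f + dirDeriv a g := by
  simp only [dirDeriv, map_add, smul_add, Finset.sum_add_distrib]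

omit [Fintype τ] in
/-- `D_a (C c) = 0`. [cite: BrandenHuh2019, §2.2 Cor. 2.11] -/
theorem dirDeriv_C (a : σ → ℝ) (c : ℝ) : dirDeriv a (C c : MvPolynomial σ ℝ) = 0 := by
  simp only [dirDeriv, pderiv_C, smul_zero, Finset.sum_const_zero]

omit [Fintype τ] in
/-- The Leibniz rule `D_a (p · X_e) = (D_a p) · X_e + a_e · p`. [cite: BrandenHuh2019, §2.2 Cor. 2.11] -/
theorem dirDeriv_mul_X [DecidableEq σ] (a : σ → ℝ) (p : MvPolynomial σ ℝ) (e : σ) :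
    dirDeriv a (p * X e) = dirDeriv a p * X e + a e • p := by
  simp only [dirDeriv, pderiv_mul, smul_add, Finset.sum_add_distrib, Finset.sum_mul, smul_mul_assoc]
  congr 1
  rw [Finset.sum_eq_single e]
  · rw [pderiv_X_self, mul_one]
  · intro k _ hk; rw [pderiv_X_of_ne (Ne.symm hk), mul_zero, smul_zero]
  · intro h; exact absurd (Finset.mem_univ e) h

omit [Fintype τ] in
/-- **The chain rule for identification of variables**: for any `φ : σ → τ` and `k ∈ τ`,
`∂_k (rename φ f) = rename φ (D_{𝟙_{φ⁻¹(k)}} f)` — differentiating `f(v_{φ(1)}, …, v_{φ(n)})` in `v_k` differentiates `f`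
in every variable identified with `v_k` ("`∂_i(f(w_1,…,w_{n-1},w_{n-1}+w_n))`" is `(∂_{n-1} + ∂_n) f` evaluated there).
[cite: BrandenHuh2019, §2.2 proof of Thm. 2.10 (III) and Cor. 2.11] -/
theorem pderiv_rename [DecidableEq σ] [DecidableEq τ] (φ : σ → τ) (k : τ) (f : MvPolynomial σ ℝ) :
    pderiv k (rename φ f) = rename φ (dirDeriv (fun e ↦ if φ e = k then 1 else 0) f) := by
  induction f using MvPolynomial.induction_on with
  | C c => rw [rename_C, pderiv_C, dirDeriv_C, map_zero]
  | add p q hp hq => rw [map_add, map_add, hp, hq, dirDeriv_add_right, map_add]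
  | mul_X p e hp =>
    rw [map_mul, rename_X, pderiv_mul, hp, dirDeriv_mul_X, map_add, map_mul, rename_X, pderiv_X]
    congr 1
    rw [Pi.single_apply]
    split_ifs with h
    · rw [one_smul, mul_one]
    · rw [zero_smul, map_zero, mul_zero]

/-- **Iterating the chain rule through Cor. 2.11**: for `f ∈ L^{d+|α|}_n` and any `φ`, `∂^α (rename φ f) = rename φ g` for
some `g ∈ L^d_n` (namely `g = D_{𝟙_{φ⁻¹(k_1)}} ⋯ D_{𝟙_{φ⁻¹(k_{|α|})}} f`, a composite of nonnegative directional
derivatives). [cite: BrandenHuh2019, §2.2 Cor. 2.11 and proof of Thm. 2.10 (III)] -/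
theorem exists_iterPderiv_rename_eq [DecidableEq σ] [DecidableEq τ] (φ : σ → τ) {d : ℕ} :
    ∀ (n : ℕ) {α : τ →₀ ℕ} {f : MvPolynomial σ ℝ}, α.degree = n → f ∈ lorentzian σ (d + n) →
      ∃ g ∈ lorentzian σ d, iterPderiv α (rename φ f) = rename φ g
  | 0, α, f, hα, hf => by
    rw [Finsupp.degree_eq_zero_iff] at hα
    subst hα
    exact ⟨f, by simpa using hf, by rw [iterPderiv_zero]⟩
  | n + 1, α, f, hα, hf => by
    have hα0 : α ≠ 0 := by intro h0; rw [h0, map_zero] at hα; exact Nat.succ_ne_zero n hα.symm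
    obtain ⟨i, hi⟩ := Finsupp.ne_iff.1 hα0
    rw [Finsupp.coe_zero, Pi.zero_apply] at hi
    have hdeg : (α - Finsupp.single i 1).degree = n := by have := degree_sub_single_add_one hi; omega
    have hD : dirDeriv (fun e ↦ if φ e = i then (1 : ℝ) else 0) f ∈ lorentzian σ (d + n) :=
      dirDeriv_mem_lorentzian (fun e ↦ by split_ifs <;> norm_num) (by rwa [← add_assoc] at hf)
    obtain ⟨g, hg, hEq⟩ := exists_iterPderiv_rename_eq φ n hdeg hD
    refine ⟨g, hg, ?_⟩
    rw [← Finsupp.sub_add_single_one_cancel hi, iterPderiv_add_single', pderiv_rename, hEq]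

end ChainRule

/-! ## §2 Coefficients and support of `rename φ f` (no cancellation for nonnegative coefficients) -/

section Coeff

omit [Fintype σ] [Fintype τ]

/-- **`coeff_γ (rename φ f) = Σ_{α ∈ supp f, φ_* α = γ} coeff_α f`** for an arbitrary map `φ`.
[cite: BrandenHuh2019, §2.2 proof of Thm. 2.10 (III) ("an elementary aggregation")] -/
theorem coeff_rename_eq_sum [DecidableEq τ] (φ : σ → τ) (f : MvPolynomial σ ℝ) (γ : τ →₀ ℕ) :
    coeff γ (rename φ f) = ∑ α ∈ f.support, if Finsupp.mapDomain φ α = γ then coeff α f else 0 := by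
  conv_lhs => rw [f.as_sum, map_sum, coeff_sum]
  refine Finset.sum_congr rfl fun α _ ↦ ?_
  rw [rename_monomial, coeff_monomial]

/-- `rename φ` preserves nonnegativity of the coefficients (any `φ`). [cite: BrandenHuh2019, §2.2 proof of Thm. 2.10 (III)] -/
theorem coeff_rename_nonneg_of_any (φ : σ → τ) {f : MvPolynomial σ ℝ} (hnn : ∀ α, 0 ≤ coeff α f) (γ : τ →₀ ℕ) :
    0 ≤ coeff γ (rename φ f) := by
  classical
  rw [coeff_rename_eq_sum]
  exact Finset.sum_nonneg fun α _ ↦ by split_ifs; exact hnn α; exact le_rfl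

/-- **The support of `rename φ f` is the push-forward `φ_* (supp f)`** when `f` has nonnegative coefficients (no
cancellation). [cite: BrandenHuh2019, §2.2 proof of Thm. 2.10 (III) ("the support […] is obtained […] by an elementary
aggregation")] -/
theorem support_rename_eq_image (φ : σ → τ) {f : MvPolynomial σ ℝ} (hnn : ∀ α, 0 ≤ coeff α f) :
    {γ | coeff γ (rename φ f) ≠ 0} = Finsupp.mapDomain φ '' {α | coeff α f ≠ 0} := by
  classical
  ext γ
  simp only [Set.mem_setOf_eq, Set.mem_image]
  constructor
  · intro h
    obtain ⟨α, hα, hc⟩ := coeff_rename_ne_zero φ f γ h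
    exact ⟨α, hc, hα⟩
  · rintro ⟨α, hα, rfl⟩
    rw [coeff_rename_eq_sum]
    refine ne_of_gt (lt_of_lt_of_le (lt_of_le_of_ne (hnn α) (Ne.symm hα)) ?_)
    have hmem : α ∈ f.support := MvPolynomial.mem_support_iff.2 hα
    refine le_trans (le_of_eq (if_pos rfl).symm) (Finset.single_le_sum (f := fun β ↦
      if Finsupp.mapDomain φ β = Finsupp.mapDomain φ α then coeff β f else 0) (fun β _ ↦ ?_) hmem)
    split_ifs; exact hnn β; exact le_rfl

end Coeff

/-! ## §3 The Hessian of `rename φ q` is the pull-back of the Hessian of `q` -/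

section HessianRename

variable [DecidableEq σ] [DecidableEq τ]

/-- **`vᵀ 𝓗_{q∘φ^*} v' = (v∘φ)ᵀ 𝓗_q (v'∘φ)`** for a quadratic form `q`: the Hessian form of `rename φ q` is the pull-back
of that of `q` along the linear map `v ↦ v ∘ φ` (from `2q(x) = xᵀ𝓗_q x`, `(rename φ q)(v) = q(v ∘ φ)` and polarization).
[cite: BrandenHuh2019, §2.1 Lemma 2.5 (the Hessian as a quadratic form); §2.2 Thm. 2.10] -/
theorem toBilin'_hessian_rename (φ : σ → τ) {q : MvPolynomial σ ℝ} (hq : q.IsHomogeneous 2) (v v' : τ → ℝ) :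
    Matrix.toBilin' (hessian (rename φ q)) v v' = Matrix.toBilin' (hessian q) (v ∘ φ) (v' ∘ φ) := by
  set B' := Matrix.toBilin' (hessian (rename φ q)) with hB'
  set B := Matrix.toBilin' (hessian q) with hB
  have hq' : (rename φ q).IsHomogeneous 2 := hq.rename_isHomogeneous
  -- diagonal values agree
  have hdiag : ∀ z : τ → ℝ, B' z z = B (z ∘ φ) (z ∘ φ) := fun z ↦ by
    rw [hB', hB, ← two_mul_eval_eq_toBilin'_hessian hq', ← two_mul_eval_eq_toBilin'_hessian hq, eval_rename]
  -- polarization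
  have hs' := isSymm_toBilin'_hessian (rename φ q)
  have hs := isSymm_toBilin'_hessian q
  have h1 := hdiag (v + v')
  have hcomp : (v + v') ∘ φ = v ∘ φ + v' ∘ φ := rfl
  rw [hcomp] at h1
  simp only [map_add, LinearMap.add_apply] at h1
  rw [hdiag v, hdiag v', symm_apply hs' v' v, symm_apply hs (v' ∘ φ) (v ∘ φ)] at h1
  linarith

/-- **Identifying variables does not increase the positive index of the Hessian of a quadratic form**:
`sigPos 𝓗_{q∘φ^*} ≤ sigPos 𝓗_q`. [cite: BrandenHuh2019, §2.2 Thm. 2.10 (III)] [cite: Serre1973, Ch. V §1.3.2] -/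
theorem sigPos_hessian_rename_le (φ : σ → τ) {q : MvPolynomial σ ℝ} (hq : q.IsHomogeneous 2) :
    sigPos (Matrix.toBilin' (hessian (rename φ q))).toQuadraticMap ≤
      sigPos (Matrix.toBilin' (hessian q)).toQuadraticMap :=
  LinearMap.BilinForm.sigPos_le_sigPos_of_comp _ _ (LinearMap.funLeft ℝ ℝ φ) fun v v' ↦ by
    rw [toBilin'_hessian_rename φ hq]; rfl

end HessianRename

/-! ## §4 Theorem 2.10 (III), general form: `rename φ` preserves `L^d` for every `φ` -/

section Main

variable [DecidableEq σ] [DecidableEq τ]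

/-- **Brändén–Huh, Theorem 2.10 (III) in general form — identifying variables preserves Lorentzian polynomials**: for
ANY map `φ : σ → τ` and `f ∈ L^d_σ`, the polynomial `rename φ f = f(X_i ↦ v_{φ(i)}) ∈ L^d_τ` ("the diagonalization
`f(w_1, …, w_{n-2}, w_{n-1}, w_{n-1})` is in `L^d_{n-1}`" is a `φ` with one two-element fibre; composites of
diagonalizations and injective renamings give every `φ`). Proof for the Definition-2.6 `lorentzian` via its second
description: the support is the aggregation `φ_*(supp f)` (M-convex by `IsMConvex.image_mapDomain_of_any`), and for
`|α| = d - 2`, `∂^α (rename φ f) = rename φ g` with `g ∈ L²_σ` a composite of nonnegative directional derivatives of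
`f` (chain rule + Cor. 2.11), whose Hessian form is a pull-back of that of `g`. [cite: BrandenHuh2019, §2.2 Thm. 2.10
(III) and its proof] -/
theorem rename_mem_lorentzian_of_any (φ : σ → τ) :
    ∀ {d : ℕ} {f : MvPolynomial σ ℝ}, f ∈ lorentzian σ d → rename φ f ∈ lorentzian τ d
  | 0, _, hf => mem_lorentzian_zero.2
      ⟨(mem_lorentzian_zero.1 hf).1.rename_isHomogeneous, coeff_rename_nonneg_of_any φ (mem_lorentzian_zero.1 hf).2⟩
  | 1, _, hf => mem_lorentzian_one.2
      ⟨(mem_lorentzian_one.1 hf).1.rename_isHomogeneous, coeff_rename_nonneg_of_any φ (mem_lorentzian_one.1 hf).2⟩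
  | m + 2, f, hf => by
    have hhom := isHomogeneous_of_mem_lorentzian hf
    have hnn := coeff_nonneg_of_mem_lorentzian hf
    refine mem_lorentzian_iff_forall_sigPos_hessian.2
      ⟨⟨hhom.rename_isHomogeneous, coeff_rename_nonneg_of_any φ hnn, ?_⟩, fun α hα ↦ ?_⟩
    · rw [support_rename_eq_image φ hnn]
      exact (isMConvex_support_of_mem_lorentzian hf).image_mapDomain_of_any φ
    · obtain ⟨g, hg, hEq⟩ := exists_iterPderiv_rename_eq φ (d := 2) m hα (by rwa [add_comm])
      rw [hEq]
      exact (sigPos_hessian_rename_le φ (isHomogeneous_of_mem_lorentzian hg)).trans (mem_lorentzian_two.1 hg).2.2.2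

/-- **The diagonalization of Theorem 2.10 (III) as printed**: identifying two variables `i ≠ j` of `f ∈ L^d_n`
(substituting `w_j := w_i`) gives a polynomial of `L^d_n`. [cite: BrandenHuh2019, §2.2 Thm. 2.10 (III) ("the
diagonalization `f(w_1, …, w_{n-2}, w_{n-1}, w_{n-1})` is in `L^d_{n-1}`")] -/
theorem rename_update_mem_lorentzian (i j : σ) {d : ℕ} {f : MvPolynomial σ ℝ} (hf : f ∈ lorentzian σ d) :
    rename (Function.update id j i) f ∈ lorentzian σ d :=
  rename_mem_lorentzian_of_any _ hf

end Main

end Literature.Combinatorics.LorentzianPolynomials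

end
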